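import Summits.AtomisticToContinuum.Crystallization.Theorems.FrustratedLawDichotomyThickeningConfig

/-!
# FrustratedLawDichotomy · crux `AperiodicFrustratedLawGap` (stmt-AtomisticToContinuum-27623) — COVARIANT THICKENING OF LAWS, part 1b:
# the thickened (pattern-selected insertion) law of a point-stationary hard-core law is point-stationary
# (decomp-a2c, prover hand 2, structural share, generation 4)

For a Giry-measurable pattern `A`, an offset `u` and the thickening map `Ins μ = μ + (μ|{p : θ_p μ ∈ A}).map (· + u)` of
`FrustratedLawDichotomyThickeningConfig`, the THICKENED LAW of a law `P` on rooted configurations is the two-type mixture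
`P ∘ Ins⁻¹ + (P|A) ∘ (θ_u ∘ Ins)⁻¹` (old root / inserted root; total mass `1 + P(A)`).

* `ae_isRootedHardCore_thickened`, `ae_isRootedHardCore_thickened_copy` — both parts are almost surely carried by rooted
  `min δ s`-hard-core configurations when the inserted sites are `s`-vacant;
* `isPointStationaryLaw_thickened` — **the thickened law of a point-stationary hard-core law is point-stationary**: its Mecke identity is
  the sum of FOUR Mecke identities of `P`, for the payloads `g(Ins μ, y)`, `1_A(μ) g(θ_u Ins μ, y − u)`, `1_A(θ_y μ) g(Ins μ, y + u)` and
  `1_A(μ) 1_A(θ_y μ) g(θ_u Ins μ, y)` (the pattern indicator is made jointly measurable through the truncated identity kernel, as in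
  `FrustratedLawDichotomyThinning`; re-rooting uses `ins_reroot_atom` / `ins_reroot_copy`).

Sequel (`FrustratedLawDichotomyThickeningStability`): THICKENING (INSERTION) STABILITY of minimising laws.  All `[folklore]`.
-/

noncomputable section

namespace Summit.AtomisticToContinuum.Crystallization.Theorems.FrustratedLawDichotomyThickening

open MeasureTheory Metric Set Filter ProbabilityTheory
open scoped ENNReal Topology BigOperators
open Literature.MathematicalPhysics.StatisticalMechanics Literature.Probability.Process
open Summit.AtomisticToContinuum.Crystallization.Theorems.ChargedEnergyGapNegative (E3 eStar)
open Summit.AtomisticToContinuum.Crystallization.Theorems.BenjaminiSchrammLimit (measurableSet_setOf_isRootedHardCore)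
open Summit.AtomisticToContinuum.Crystallization.Theorems.FrustratedLawDichotomyFiniteClusterGap
  (ae_mem_of_sep exists_kernel_eq_count_restrict measurable_kernel_map_sub aemeasurable_lintegral_of_ae_hardCore
    aemeasurable_lintegral_reroot_of_ae_hardCore measurable_reroot_section map_add_count_restrict)
open Summit.AtomisticToContinuum.Crystallization.Theorems.FrustratedLawDichotomyThinning
  (exists_measurable_thinning thin_reroot map_sub_map_sub map_sub_map_sub_neg)

variable {δ : ℝ} {A : Set (Measure E3)}

/-! ## §3. The thickened law is point-stationary -/

section Stationary

variable {P : Measure (Measure E3)}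

/-- The thickened law `P ∘ Ins⁻¹` is almost surely carried by rooted `min δ s`-hard-core configurations. [folklore] -/
theorem ae_isRootedHardCore_thickened (hδ : 0 < δ) {s : ℝ} (hs : 0 < s) (hcore : ∀ᵐ μ ∂P, IsRootedHardCore δ μ) (u : E3)
    (hV : ∀ᵐ μ ∂P, ∀ p q : E3, μ {p} ≠ 0 → μ {q} ≠ 0 → μ.map (fun x : E3 => x - p) ∈ A → s ≤ dist q (p + u))
    {I : Measure E3 → Measure E3} (hIm : Measurable I)
    (hI : ∀ μ : Measure E3, IsRootedHardCore δ μ → MeasurableSet {p : E3 | μ.map (fun x : E3 => x - p) ∈ A} ∧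
      I μ = μ + (μ.restrict {p : E3 | μ.map (fun x : E3 => x - p) ∈ A}).map (fun z => z + u)) :
    ∀ᵐ ν ∂(P.map I), IsRootedHardCore (min δ s) ν := by
  refine (ae_map_iff hIm.aemeasurable (measurableSet_setOf_isRootedHardCore (lt_min hδ hs))).2 ?_
  filter_upwards [hcore, hV] with μ hμ hμV
  obtain ⟨hK, hIμ⟩ := hI μ hμ
  rw [hIμ]
  exact isRootedHardCore_ins hδ hs hμ hK hμV

/-- The copy-rooted part `(P|A) ∘ (θ_u ∘ Ins)⁻¹` of the thickened law is almost surely carried by rooted `min δ s`-hard-core configurations.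
[folklore] -/
theorem ae_isRootedHardCore_thickened_copy (hδ : 0 < δ) {s : ℝ} (hs : 0 < s) (hcore : ∀ᵐ μ ∂P, IsRootedHardCore δ μ)
    (hA : MeasurableSet A) (u : E3)
    (hV : ∀ᵐ μ ∂P, ∀ p q : E3, μ {p} ≠ 0 → μ {q} ≠ 0 → μ.map (fun x : E3 => x - p) ∈ A → s ≤ dist q (p + u))
    {I : Measure E3 → Measure E3} (hIm : Measurable I)
    (hI : ∀ μ : Measure E3, IsRootedHardCore δ μ → MeasurableSet {p : E3 | μ.map (fun x : E3 => x - p) ∈ A} ∧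
      I μ = μ + (μ.restrict {p : E3 | μ.map (fun x : E3 => x - p) ∈ A}).map (fun z => z + u)) :
    ∀ᵐ ν ∂((P.restrict A).map fun μ => (I μ).map (fun z => z - u)), IsRootedHardCore (min δ s) ν := by
  have hJm : Measurable fun μ : Measure E3 => (I μ).map (fun z => z - u) :=
    (Measure.measurable_map _ (measurable_sub_const u)).comp hIm
  refine (ae_map_iff hJm.aemeasurable (measurableSet_setOf_isRootedHardCore (lt_min hδ hs))).2 ?_
  filter_upwards [ae_restrict_of_ae (s := A) hcore, ae_restrict_of_ae (s := A) hV, ae_restrict_mem hA] with μ hμ hμV hμA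
  obtain ⟨hK, hIμ⟩ := hI μ hμ
  rw [hIμ]
  exact isRootedHardCore_ins_copy hδ hs hμ hK hμV hμA

/-- **THE THICKENED LAW IS POINT-STATIONARY.**  Let `P` be point-stationary and almost surely carried by rooted `δ`-hard-core configurations in
which the sites `p + u`, `θ_p μ ∈ A`, are `s`-vacant; let `I` be a measurable thickening map (`exists_measurable_ins`).  Then the two-type
mixture `P ∘ I⁻¹ + (P|A) ∘ (θ_u ∘ I)⁻¹` (old root / inserted root) is point-stationary: its Mecke identity is the sum of four Mecke identities of
`P`. [folklore] -/
theorem isPointStationaryLaw_thickened (hδ : 0 < δ) {s : ℝ} (hs : 0 < s) (hcore : ∀ᵐ μ ∂P, IsRootedHardCore δ μ)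
    (hstat : IsPointStationaryLaw P) (hA : MeasurableSet A) (u : E3)
    (hV : ∀ᵐ μ ∂P, ∀ p q : E3, μ {p} ≠ 0 → μ {q} ≠ 0 → μ.map (fun x : E3 => x - p) ∈ A → s ≤ dist q (p + u))
    {I : Measure E3 → Measure E3} (hIm : Measurable I)
    (hI : ∀ μ : Measure E3, IsRootedHardCore δ μ → MeasurableSet {p : E3 | μ.map (fun x : E3 => x - p) ∈ A} ∧
      I μ = μ + (μ.restrict {p : E3 | μ.map (fun x : E3 => x - p) ∈ A}).map (fun z => z + u)) :
    IsPointStationaryLaw (P.map I + (P.restrict A).map fun μ => (I μ).map (fun z => z - u)) := by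
  classical
  intro g hg
  have hδ' : 0 < min δ s := lt_min hδ hs
  set J : Measure E3 → Measure E3 := fun μ => (I μ).map (fun z => z - u) with hJdef
  have hJm : Measurable J := (Measure.measurable_map _ (measurable_sub_const u)).comp hIm
  have hcoreI := ae_isRootedHardCore_thickened hδ hs hcore u hV hIm hI
  have hcoreJ : ∀ᵐ ν ∂((P.restrict A).map J), IsRootedHardCore (min δ s) ν :=
    ae_isRootedHardCore_thickened_copy hδ hs hcore hA u hV hIm hI
  -- a jointly measurable version of the pattern relation `θ_y μ ∈ A` (truncated identity kernel)
  obtain ⟨κ, hκs, hκ⟩ := exists_kernel_eq_count_restrict hδ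
  have hκid : ∀ μ : Measure E3, IsRootedHardCore δ μ → κ μ = μ := by
    rintro μ ⟨S, -, hsep, rfl⟩; exact hκ S hsep
  set B : Set (Measure E3 × E3) := (fun q : Measure E3 × E3 => (κ q.1).map fun z => z - q.2) ⁻¹' A with hBdef
  have hB : MeasurableSet B := measurable_kernel_map_sub κ hA
  have hsec : ∀ μ : Measure E3, IsRootedHardCore δ μ → ∀ y : E3,
      ((μ, y) ∈ B ↔ y ∈ {p : E3 | μ.map (fun x : E3 => x - p) ∈ A}) := fun μ hμ y => by
    simp only [hBdef, Set.mem_preimage, Set.mem_setOf_eq, hκid μ hμ]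
  -- the transported payload: four pieces
  set G : Measure E3 → E3 → ℝ≥0∞ := fun μ y =>
    g (I μ) y + A.indicator (fun _ => (1 : ℝ≥0∞)) μ * g (J μ) (y - u) +
      B.indicator (fun _ => (1 : ℝ≥0∞)) (μ, y) * g (I μ) (y + u) +
      A.indicator (fun _ => (1 : ℝ≥0∞)) μ * (B.indicator (fun _ => (1 : ℝ≥0∞)) (μ, y) * g (J μ) y) with hGdef
  have hgI : Measurable (Function.uncurry fun (μ : Measure E3) (y : E3) => g (I μ) y) :=
    hg.comp ((hIm.comp measurable_fst).prodMk measurable_snd)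
  have hgIu : Measurable (Function.uncurry fun (μ : Measure E3) (y : E3) => g (I μ) (y + u)) :=
    hg.comp ((hIm.comp measurable_fst).prodMk (measurable_snd.add_const u))
  have hgJ : Measurable (Function.uncurry fun (μ : Measure E3) (y : E3) => g (J μ) y) :=
    hg.comp ((hJm.comp measurable_fst).prodMk measurable_snd)
  have hgJu : Measurable (Function.uncurry fun (μ : Measure E3) (y : E3) => g (J μ) (y - u)) :=
    hg.comp ((hJm.comp measurable_fst).prodMk (measurable_snd.sub_const u))
  have h1A : Measurable fun q : Measure E3 × E3 => A.indicator (fun _ => (1 : ℝ≥0∞)) q.1 :=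
    (measurable_const.indicator hA).comp measurable_fst
  have h1B : Measurable fun q : Measure E3 × E3 => B.indicator (fun _ => (1 : ℝ≥0∞)) q := measurable_const.indicator hB
  have hGm : Measurable (Function.uncurry G) :=
    ((hgI.add (h1A.mul hgJu)).add (h1B.mul hgIu)).add (h1A.mul (h1B.mul hgJ))
  have key := hstat G hGm
  -- the two Campbell functionals
  set Φ : Measure E3 → ℝ≥0∞ := fun ν => ∫⁻ y, g ν y ∂ν with hΦ
  set Ψ : Measure E3 → ℝ≥0∞ := fun ν => ∫⁻ y, g (ν.map fun z => z - y) (-y) ∂ν with hΨ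
  have hΦI : AEMeasurable (fun μ => Φ (I μ)) P := (aemeasurable_lintegral_of_ae_hardCore hδ' hcoreI hg).comp_measurable hIm
  have hΨI : AEMeasurable (fun μ => Ψ (I μ)) P := (aemeasurable_lintegral_reroot_of_ae_hardCore hδ' hcoreI hg).comp_measurable hIm
  -- the payload shifted by `u` (for measurable sections)
  have hgu : Measurable (Function.uncurry fun (ν : Measure E3) (z : E3) => g ν (z + u)) :=
    hg.comp (measurable_fst.prodMk (measurable_snd.add_const u))
  -- LEFT: `∫ Φ d(P∘I⁻¹) + ∫ Φ d((P|A)∘J⁻¹) = ∫∫ G dμ dP`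
  have hL : ∫⁻ ν, Φ ν ∂(P.map I + (P.restrict A).map J) = ∫⁻ μ, ∫⁻ y, G μ y ∂μ ∂P := by
    rw [lintegral_add_measure, lintegral_map' (aemeasurable_lintegral_of_ae_hardCore hδ' hcoreI hg) hIm.aemeasurable,
      lintegral_map' (aemeasurable_lintegral_of_ae_hardCore hδ' hcoreJ hg) hJm.aemeasurable, ← lintegral_indicator hA,
      ← lintegral_add_left' hΦI]
    refine lintegral_congr_ae ?_
    filter_upwards [hcore, hV] with μ hμ hμV
    obtain ⟨hK, hIμ⟩ := hI μ hμ
    set K : Set E3 := {p : E3 | μ.map (fun x : E3 => x - p) ∈ A} with hKdef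
    -- measurable sections
    have hsI : Measurable fun y : E3 => g (I μ) y := hg.comp measurable_prodMk_left
    have hsIu : Measurable fun y : E3 => g (I μ) (y + u) := hsI.comp (measurable_add_const u)
    have hsJ : Measurable fun y : E3 => g (J μ) y := hg.comp measurable_prodMk_left
    have hsJu : Measurable fun y : E3 => g (J μ) (y - u) := hsJ.comp (measurable_sub_const u)
    -- `Φ (I μ)` and `Φ (J μ)` as sums over `μ`
    have hΦIμ : Φ (I μ) = ∫⁻ y, g (I μ) y ∂μ + ∫⁻ y, K.indicator (fun y => g (I μ) (y + u)) y ∂μ := by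
      have e : Φ (I μ) = ∫⁻ y, g (I μ) y ∂(μ + (μ.restrict K).map (fun z => z + u)) := by simp only [hΦ]; rw [← hIμ]
      rw [e, lintegral_ins μ hK u hsI]
    have hΦJμ : ∫⁻ y, g (J μ) y ∂(J μ) = ∫⁻ y, g (J μ) (y - u) ∂μ + ∫⁻ y, K.indicator (fun y => g (J μ) y) y ∂μ := by
      have e : ∫⁻ y, g (J μ) y ∂(J μ) = ∫⁻ y, g (J μ) y ∂((μ + (μ.restrict K).map (fun z => z + u)).map fun z => z - u) := by
        rw [← hIμ]
      rw [e, lintegral_map hsJ (measurable_sub_const u), lintegral_ins μ hK u hsJu]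
      simp only [add_sub_cancel_right]
    -- the payload on this configuration
    have hGμ : ∀ y : E3, G μ y = g (I μ) y + A.indicator (fun _ => (1 : ℝ≥0∞)) μ * g (J μ) (y - u) +
        K.indicator (fun y => g (I μ) (y + u)) y + A.indicator (fun _ => (1 : ℝ≥0∞)) μ * K.indicator (fun y => g (J μ) y) y := by
      intro y
      simp only [hGdef]
      by_cases hy : y ∈ K
      · rw [Set.indicator_of_mem ((hsec μ hμ y).2 hy), Set.indicator_of_mem hy, Set.indicator_of_mem hy, one_mul, one_mul]
      · rw [Set.indicator_of_notMem (fun h => hy ((hsec μ hμ y).1 h)), Set.indicator_of_notMem hy, Set.indicator_of_notMem hy,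
          zero_mul, zero_mul, mul_zero]
    simp_rw [hGμ]
    rw [lintegral_add₄ μ hsI hsJu (hsIu.indicator hK) (hsJ.indicator hK)]
    by_cases hμA : μ ∈ A
    · rw [Set.indicator_of_mem hμA, Set.indicator_of_mem hμA, one_mul, one_mul, hΦIμ, hΦJμ]
      ring
    · simp only [Set.indicator_of_notMem hμA, zero_mul, add_zero, hΦIμ]
  -- RIGHT: `∫ Ψ d(P∘I⁻¹) + ∫ Ψ d((P|A)∘J⁻¹) = ∫∫ G(θ_y μ, -y) dμ dP`
  have hR : ∫⁻ ν, Ψ ν ∂(P.map I + (P.restrict A).map J) = ∫⁻ μ, ∫⁻ y, G (μ.map fun x : E3 => x - y) (-y) ∂μ ∂P := by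
    rw [lintegral_add_measure, lintegral_map' (aemeasurable_lintegral_reroot_of_ae_hardCore hδ' hcoreI hg) hIm.aemeasurable,
      lintegral_map' (aemeasurable_lintegral_reroot_of_ae_hardCore hδ' hcoreJ hg) hJm.aemeasurable, ← lintegral_indicator hA,
      ← lintegral_add_left' hΨI]
    refine lintegral_congr_ae ?_
    filter_upwards [hcore, hV] with μ hμ hμV
    obtain ⟨hK, hIμ⟩ := hI μ hμ
    set K : Set E3 := {p : E3 | μ.map (fun x : E3 => x - p) ∈ A} with hKdef
    have hIμ' : IsRootedHardCore (min δ s) (I μ) := by rw [hIμ]; exact isRootedHardCore_ins hδ hs hμ hK hμV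
    have hμ' := hμ
    obtain ⟨S, h0S, hsep, rfl⟩ := hμ
    have hae : ∀ᵐ y ∂((Measure.count : Measure E3).restrict S), y ∈ S := ae_mem_of_sep hδ hsep
    -- re-rooted thickened configurations, at the atoms of `count|S`
    have hreI : ∀ y ∈ S, (I ((Measure.count : Measure E3).restrict S)).map (fun x : E3 => x - y) =
        I (((Measure.count : Measure E3).restrict S).map fun x : E3 => x - y) := fun y hy => by
      have hy' : (Measure.count : Measure E3).restrict S {y} ≠ 0 := (count_restrict_singleton_ne_zero_iff S y).2 hy
      obtain ⟨-, hIθ⟩ := hI _ (hμ'.map_sub hy')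
      rw [hIθ, hIμ, ins_reroot_atom hμ' hK u y]
    have hreJ : ∀ y ∈ S, (I ((Measure.count : Measure E3).restrict S)).map (fun x : E3 => x - (y + u)) =
        J (((Measure.count : Measure E3).restrict S).map fun x : E3 => x - y) := fun y hy => by
      have hy' : (Measure.count : Measure E3).restrict S {y} ≠ 0 := (count_restrict_singleton_ne_zero_iff S y).2 hy
      obtain ⟨-, hIθ⟩ := hI _ (hμ'.map_sub hy')
      show _ = (I _).map _
      rw [hIθ, hIμ, ins_reroot_copy hμ' hK u y]
    -- measurable sections
    have hsI : Measurable fun y : E3 => g ((I ((Measure.count : Measure E3).restrict S)).map fun x : E3 => x - y) (-y) :=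
      measurable_reroot_section hδ' hIμ' hg
    have hsIu : Measurable fun y : E3 =>
        g ((I ((Measure.count : Measure E3).restrict S)).map fun x : E3 => x - (y + u)) (-(y + u)) :=
      hsI.comp (measurable_add_const u)
    have hs3 : Measurable fun y : E3 => g ((I ((Measure.count : Measure E3).restrict S)).map fun x : E3 => x - y) (-(y - u)) := by
      have h := measurable_reroot_section hδ' hIμ' hgu
      convert h using 2 with y
      abel_nf
    have hs4 : Measurable fun y : E3 => g ((I ((Measure.count : Measure E3).restrict S)).map fun x : E3 => x - (y + u)) (-y) := by
      have h := (measurable_reroot_section hδ' hIμ' hgu).comp (measurable_add_const u)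
      convert h using 2 with y
      simp only [Function.comp_apply]
      abel_nf
    -- `Ψ (I μ)` as a sum over `μ`
    have hΨIμ : Ψ (I ((Measure.count : Measure E3).restrict S)) =
        ∫⁻ y, g ((I ((Measure.count : Measure E3).restrict S)).map fun x : E3 => x - y) (-y) ∂((Measure.count : Measure E3).restrict S) +
        ∫⁻ y, K.indicator (fun y => g ((I ((Measure.count : Measure E3).restrict S)).map fun x : E3 => x - (y + u)) (-(y + u))) y
          ∂((Measure.count : Measure E3).restrict S) := by
      have e : Ψ (I ((Measure.count : Measure E3).restrict S)) =
          ∫⁻ y, g ((I ((Measure.count : Measure E3).restrict S)).map fun x : E3 => x - y) (-y)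
            ∂((Measure.count : Measure E3).restrict S + (((Measure.count : Measure E3).restrict S).restrict K).map (fun z => z + u)) := by
        simp only [hΨ]; rw [← hIμ]
      rw [e, lintegral_ins _ hK u hsI]
    -- the payload re-rooted at an atom `y ∈ S`
    have hGθ : ∀ y ∈ S, G (((Measure.count : Measure E3).restrict S).map fun x : E3 => x - y) (-y) =
        g ((I ((Measure.count : Measure E3).restrict S)).map fun x : E3 => x - y) (-y) +
        A.indicator (fun _ => (1 : ℝ≥0∞)) ((Measure.count : Measure E3).restrict S) *
          g ((I ((Measure.count : Measure E3).restrict S)).map fun x : E3 => x - y) (-(y - u)) +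
        K.indicator (fun y => g ((I ((Measure.count : Measure E3).restrict S)).map fun x : E3 => x - (y + u)) (-(y + u))) y +
        A.indicator (fun _ => (1 : ℝ≥0∞)) ((Measure.count : Measure E3).restrict S) *
          K.indicator (fun y => g ((I ((Measure.count : Measure E3).restrict S)).map fun x : E3 => x - (y + u)) (-y)) y := by
      intro y hy
      have hy' : (Measure.count : Measure E3).restrict S {y} ≠ 0 := (count_restrict_singleton_ne_zero_iff S y).2 hy
      have hθ : IsRootedHardCore δ (((Measure.count : Measure E3).restrict S).map fun x : E3 => x - y) := hμ'.map_sub hy'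
      -- the two indicators after re-rooting
      have h1 : A.indicator (fun _ => (1 : ℝ≥0∞)) (((Measure.count : Measure E3).restrict S).map fun x : E3 => x - y) =
          K.indicator (fun _ => (1 : ℝ≥0∞)) y := by
        by_cases h : ((Measure.count : Measure E3).restrict S).map (fun x : E3 => x - y) ∈ A
        · rw [Set.indicator_of_mem h, Set.indicator_of_mem (show y ∈ K from h)]
        · rw [Set.indicator_of_notMem h, Set.indicator_of_notMem (show y ∉ K from h)]
      have h2 : B.indicator (fun _ => (1 : ℝ≥0∞)) ((((Measure.count : Measure E3).restrict S).map fun x : E3 => x - y), -y) =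
          A.indicator (fun _ => (1 : ℝ≥0∞)) ((Measure.count : Measure E3).restrict S) := by
        have hmem : ((((Measure.count : Measure E3).restrict S).map fun x : E3 => x - y), -y) ∈ B ↔
            (Measure.count : Measure E3).restrict S ∈ A := by
          rw [hsec _ hθ (-y), Set.mem_setOf_eq, map_sub_map_sub_neg]
        by_cases h : (Measure.count : Measure E3).restrict S ∈ A
        · rw [Set.indicator_of_mem h, Set.indicator_of_mem (hmem.2 h)]
        · rw [Set.indicator_of_notMem h, Set.indicator_of_notMem (fun h' => h (hmem.1 h'))]
      simp only [hGdef]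
      rw [h1, h2, ← hreI y hy, ← hreJ y hy, show -y - u = -(y + u) by abel, show -y + u = -(y - u) by abel]
      by_cases hyK : y ∈ K
      · simp only [Set.indicator_of_mem hyK, one_mul]
        ring
      · simp only [Set.indicator_of_notMem hyK, zero_mul, mul_zero, add_zero]
    rw [lintegral_congr_ae (hae.mono hGθ), lintegral_add₄ _ hsI hs3 (hsIu.indicator hK) (hs4.indicator hK)]
    by_cases hμA : (Measure.count : Measure E3).restrict S ∈ A
    · -- the copy-rooted functional, expanded (the copy-rooted configuration is hard-core since the root shows the pattern)
      have hJμ' : IsRootedHardCore (min δ s) (J ((Measure.count : Measure E3).restrict S)) := by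
        show IsRootedHardCore (min δ s) ((I _).map _)
        rw [hIμ]; exact isRootedHardCore_ins_copy hδ hs hμ' hK hμV hμA
      have hsJ : Measurable fun y : E3 => g ((J ((Measure.count : Measure E3).restrict S)).map fun x : E3 => x - y) (-y) :=
        measurable_reroot_section hδ' hJμ' hg
      have hJθ : ∀ y : E3, (J ((Measure.count : Measure E3).restrict S)).map (fun x : E3 => x - (y - u)) =
          (I ((Measure.count : Measure E3).restrict S)).map fun x : E3 => x - y := fun y => by
        show ((I _).map _).map _ = _
        rw [map_sub_map_sub, sub_add_cancel]
      have hΨJμ : ∫⁻ y, g ((J ((Measure.count : Measure E3).restrict S)).map fun x : E3 => x - y) (-y)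
            ∂(J ((Measure.count : Measure E3).restrict S)) =
          ∫⁻ y, g ((I ((Measure.count : Measure E3).restrict S)).map fun x : E3 => x - y) (-(y - u)) ∂((Measure.count : Measure E3).restrict S) +
          ∫⁻ y, K.indicator (fun y => g ((I ((Measure.count : Measure E3).restrict S)).map fun x : E3 => x - (y + u)) (-y)) y
            ∂((Measure.count : Measure E3).restrict S) := by
        have e : ∫⁻ y, g ((J ((Measure.count : Measure E3).restrict S)).map fun x : E3 => x - y) (-y)
              ∂(J ((Measure.count : Measure E3).restrict S)) =
            ∫⁻ y, g ((J ((Measure.count : Measure E3).restrict S)).map fun x : E3 => x - y) (-y)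
              ∂((Measure.count : Measure E3).restrict S +
                  (((Measure.count : Measure E3).restrict S).restrict K).map (fun z => z + u)).map fun z => z - u := by
          rw [← hIμ]
        rw [e, lintegral_map hsJ (measurable_sub_const u)]
        simp_rw [hJθ]
        rw [lintegral_ins _ hK u hs3]
        simp only [add_sub_cancel_right]
      rw [Set.indicator_of_mem hμA, Set.indicator_of_mem hμA, one_mul, one_mul, hΨIμ, hΨJμ]
      ring
    · simp only [Set.indicator_of_notMem hμA, zero_mul, add_zero, hΨIμ]
  rw [hL, hR]
  exact key

end Stationary

end Summit.AtomisticToContinuum.Crystallization.Theorems.FrustratedLawDichotomyThickening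

end
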